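import Mathlib.Analysis.Distribution.SchwartzSpace.Fourier
import Mathlib.Analysis.Fourier.Inversion
import Mathlib.MeasureTheory.Measure.Haar.InnerProductSpace
import Mathlib.MeasureTheory.Measure.Haar.Unique
import Mathlib.Analysis.InnerProductSpace.ProdL2
import HarnessLib

/-!
# Crux `HLiu418`, road `K2_Liu`, socket #42R — organ (FI∞): THE FIBRE INTEGRAL OF A SCHWARTZ FUNCTION IS A SCHWARTZ FUNCTION

Cell `hodgecm-mathlib`, crux item hLiu418 = `stmt-HodgeConjecture-24832`; squad K2 ∕ K2Liu, LEAD F0P6-plan (g11) ruling «M-155e» (3)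
«Ikeda DEFS» (2026-09-04), prover K2Liu-p02 (g4), steward lineage of socket #42R `sig_K2LiuEisensteinResidueIsThetaIntegral`.
THEOREMS ONLY (no `def` ∕ instance ∕ notation ∕ named-fact hypothesis ∕ `sorry`, default heartbeats); lane
`--supports stmt-HodgeConjecture-24832 --as helper` (count-neutral).  GENERIC real analysis (Mathlib's `SchwartzMap`).

WHY (#42R road «generators», #42F «first-term identity on generators»): the Ikeda map `S((𝔻 ⊗ V′₃)⁺(𝔸)) → S((𝔻 ⊗ a′)⁺(𝔸))`
of [KudlaRallis1994, §5] ∕ [Liu2021, App. B p. 104] is, in the tree's Schrödinger models `piSchwartzBruhat (Fp L) (Fin k)`, a rational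
mover `ω(r_F(δ))` followed by INTEGRATION ALONG A BLOCK OF COORDINATES `𝒮(𝔸^{ι₁ ⊕ ι₂}) → 𝒮(𝔸^{ι₁})`; this file is the archimedean
half of that organ.  For finite-dimensional real normed spaces `E₁, E₂`, an additive Haar measure `μ` on `E₂` and a Schwartz
function `f ∈ 𝓢(E₁ × E₂, F)` with values in a complete complex normed space `F`, the FIBRE INTEGRAL

  `g(x) = ∫ f(x, y) dμ(y)`

is (the underlying function of) a Schwartz function `g ∈ 𝓢(E₁, F)` (`exists_schwartz_fibreIntegral`); the same
for the coordinate splitting of a `Sum`-indexed product, `g(x) = ∫ f(Sum.elim x y) dμ(y)` on `ι₁ → W` for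
`f ∈ 𝓢(ι₁ ⊕ ι₂ → W, F)` (`exists_schwartz_fibreIntegral_sumElim`) — the case `W = mixedSpace L⁺ = L⁺ ⊗ ℝ` is the archimedean
factor `𝒮((L⁺ ⊗ ℝ)^{ι₁ ⊕ ι₂})` of ★ `piSchwartzBruhat`.  The stability of `𝒮` under such operations is [Weil1964, Chap. I n° 11]
(after L. Schwartz ∕ F. Bruhat); the analysis below is folklore and the citations locate the use.

PROOF WITHOUT DIFFERENTIATING UNDER THE INTEGRAL SIGN.  In Euclidean models `U, V` (Mathlib's Fourier transform lives on
finite-dimensional inner product spaces with their volume) and on the `L²`-product `WithLp 2 (U × V)` (an inner product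
space whose volume is the product volume, `WithLp.volume_preserving_toLp`):
* `g` is continuous and integrable (dominated convergence ∕ Fubini against the Schwartz decay
  `‖f(u, v)‖ ≤ C (1 + ‖v‖)^{-k}`);
* **`𝓕 g (ξ) = 𝓕 f (ξ, 0)`** (Fubini: `⟪(u, v), (ξ, 0)⟫ = ⟪u, ξ⟫`), and `ξ ↦ 𝓕 f (ξ, 0)` IS a Schwartz function — the
  restriction of `𝓕 f ∈ 𝓢` along the linear isometry `ξ ↦ (ξ, 0)` (Mathlib `SchwartzMap.compCLM`);
* hence `𝓕 g` is integrable and Fourier inversion (`Continuous.fourierInv_fourier_eq`) gives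
  `g = 𝓕⁻¹(𝓕 g) = 𝓕⁻¹(ξ ↦ 𝓕 f(ξ, 0)) ∈ 𝓢(U, F)`.
The general statement follows by transport along linear isomorphisms `E_j ≃ ℝ^{d_j}`
(`SchwartzMap.compCLMOfContinuousLinearEquiv`) and uniqueness of Haar measure (`Measure.isAddLeftInvariant_eq_smul`).

Main results:
* `schwartz_norm_le_mul_one_add_norm_rpow_neg` — Schwartz decay with a real exponent;
* `integrable_fibre_withLp`, `continuous_fibreIntegral_withLp`, `integrable_fibreIntegral_withLp`,
  `fourier_fibreIntegral_withLp`, `exists_fibreIntegral_withLp` — the Euclidean core;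
* `exists_schwartz_fibreIntegral`, `exists_schwartz_fibreIntegral_left` (integrating out the first variable),
  `exists_schwartz_fibreIntegral_sumElim` — the general statements.

NOT here: the continuity of `f ↦ g` for the Schwartz topologies (true; not needed by the adelic consumer), the
finite-adelic half and the `piSchwartzBruhat` assembly (organ (FI), next file), the mover and the FTI constant (#42N ∕ #42F).
HONEST LABEL.  Count-neutral helper; it pays nothing by itself: `HC_CM` is proved only modulo the 7 printed citations
(2 remaining named inputs: hLiu418 = `stmt-HodgeConjecture-24832`, h413 = `stmt-HodgeConjecture-24833`) until rung 0 closes.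

## References
* L. Hörmander, *The Analysis of Linear Partial Differential Operators I*, Thm. 7.1.5 (`𝓕` is an isomorphism of `𝒮`).
* A. Weil, *Sur certains groupes d'opérateurs unitaires*, Acta Math. 111 (1964), Chap. I n° 11 [Weil1964].
* S. Kudla, S. Rallis, *A regularized Siegel–Weil formula: the first term identity*, Ann. of Math. 140 (1994), §5
  [KudlaRallis1994].
* Y. Liu, *Fourier–Jacobi cycles and arithmetic relative trace formula*, Camb. J. Math. 9 (2021), App. B p. 104 [Liu2021].
-/

set_option autoImplicit false
-- the mandated namespace repeats the single-problem summit's segment (`HodgeConjecture.HodgeConjecture`)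
set_option linter.dupNamespace false

noncomputable section

open MeasureTheory MeasureTheory.Measure Real
open scoped FourierTransform SchwartzMap RealInnerProductSpace ENNReal NNReal

namespace Summit.HodgeConjecture.HodgeConjecture.Cruxes.HLiu418.K2LiuSchwartzFibreIntegral

/-! ### Schwartz decay with a real exponent -/

/-- **Schwartz decay, real-exponent form**: for `f ∈ 𝓢(E, F)` and `k : ℕ` there is `C ≥ 0` with
`‖f z‖ ≤ C · (1 + ‖z‖)^{-k}` for all `z`. [cite: Weil1964, Chap. I n° 11] -/
theorem schwartz_norm_le_mul_one_add_norm_rpow_neg {E F : Type*} [NormedAddCommGroup E]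
    [NormedSpace ℝ E] [NormedAddCommGroup F] [NormedSpace ℝ F] (f : 𝓢(E, F)) (k : ℕ) :
    ∃ C : ℝ, 0 ≤ C ∧ ∀ z, ‖f z‖ ≤ C * (1 + ‖z‖) ^ (-(k : ℝ)) := by
  refine ⟨2 ^ k * (Finset.Iic (k, 0)).sup (fun m => SchwartzMap.seminorm ℝ m.1 m.2) f, by positivity,
    fun z => ?_⟩
  have h := SchwartzMap.one_add_le_sup_seminorm_apply (𝕜 := ℝ) (m := (k, 0)) le_rfl le_rfl f z
  rw [norm_iteratedFDeriv_zero] at h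
  have hpos : 0 < 1 + ‖z‖ := by positivity
  rw [Real.rpow_neg hpos.le, Real.rpow_natCast, ← div_eq_mul_inv, le_div_iff₀ (pow_pos hpos _),
    mul_comm (‖f z‖)]
  exact h

/-! ### The Euclidean core: `f ∈ 𝓢(WithLp 2 (U × V), F)` -/

section Slices

variable {U V : Type*} [TopologicalSpace U] [TopologicalSpace V]

/-- For fixed `u`, `v ↦ (u, v) ∈ WithLp 2 (U × V)` is continuous. [cite: Weil1964, Chap. I n° 11] -/
theorem continuous_toLp_right (u : U) : Continuous fun v : V => WithLp.toLp 2 (u, v) :=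
  (WithLp.prod_continuous_toLp 2 U V).comp (continuous_const.prodMk continuous_id)

/-- For fixed `v`, `u ↦ (u, v) ∈ WithLp 2 (U × V)` is continuous. [cite: Weil1964, Chap. I n° 11] -/
theorem continuous_toLp_left (v : V) : Continuous fun u : U => WithLp.toLp 2 (u, v) :=
  (WithLp.prod_continuous_toLp 2 U V).comp (continuous_id.prodMk continuous_const)

end Slices

section Core

variable {U V : Type*} [NormedAddCommGroup U] [InnerProductSpace ℝ U] [FiniteDimensional ℝ U]
  [MeasurableSpace U] [BorelSpace U]
  [NormedAddCommGroup V] [InnerProductSpace ℝ V] [FiniteDimensional ℝ V]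
  [MeasurableSpace V] [BorelSpace V]
  {F : Type*} [NormedAddCommGroup F] [NormedSpace ℂ F]

omit [FiniteDimensional ℝ U] [MeasurableSpace U] [BorelSpace U] [FiniteDimensional ℝ V] [MeasurableSpace V]
  [BorelSpace V] in
/-- Decay of a Schwartz function on `WithLp 2 (U × V)` in the SECOND variable, uniformly in the first:
`‖f(u, v)‖ ≤ C · (1 + ‖v‖)^{-k}` (since `‖v‖ ≤ ‖(u, v)‖₂`). [cite: Weil1964, Chap. I n° 11] -/
theorem exists_norm_fibre_le_withLp (f : 𝓢(WithLp 2 (U × V), F)) (k : ℕ) :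
    ∃ C : ℝ, 0 ≤ C ∧ ∀ u v, ‖f (WithLp.toLp 2 (u, v))‖ ≤ C * (1 + ‖v‖) ^ (-(k : ℝ)) := by
  obtain ⟨C, hC, h⟩ := schwartz_norm_le_mul_one_add_norm_rpow_neg f k
  refine ⟨C, hC, fun u v => (h _).trans ?_⟩
  have hv : ‖v‖ ≤ ‖WithLp.toLp 2 (u, v)‖ := by
    simpa using WithLp.norm_snd_le (p := 2) (α := U) (β := V) (WithLp.toLp 2 (u, v))
  have hpos : 0 < 1 + ‖v‖ := by positivity
  gcongr C * ?_
  exact Real.rpow_le_rpow_of_nonpos hpos (by linarith) (by simp)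

omit [FiniteDimensional ℝ U] [MeasurableSpace U] [BorelSpace U] [FiniteDimensional ℝ V] [MeasurableSpace V]
  [BorelSpace V] in
/-- Decay of a Schwartz function on `WithLp 2 (U × V)` in the FIRST variable, uniformly in the second:
`‖f(u, v)‖ ≤ C · (1 + ‖u‖)^{-k}`. [cite: Weil1964, Chap. I n° 11] -/
theorem exists_norm_fibre_le_withLp_fst (f : 𝓢(WithLp 2 (U × V), F)) (k : ℕ) :
    ∃ C : ℝ, 0 ≤ C ∧ ∀ u v, ‖f (WithLp.toLp 2 (u, v))‖ ≤ C * (1 + ‖u‖) ^ (-(k : ℝ)) := by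
  obtain ⟨C, hC, h⟩ := schwartz_norm_le_mul_one_add_norm_rpow_neg f k
  refine ⟨C, hC, fun u v => (h _).trans ?_⟩
  have hu : ‖u‖ ≤ ‖WithLp.toLp 2 (u, v)‖ := by
    simpa using WithLp.norm_fst_le (p := 2) (α := U) (β := V) (WithLp.toLp 2 (u, v))
  have hpos : 0 < 1 + ‖u‖ := by positivity
  gcongr C * ?_
  exact Real.rpow_le_rpow_of_nonpos hpos (by linarith) (by simp)

omit [FiniteDimensional ℝ U] [MeasurableSpace U] [BorelSpace U] in
/-- **Each fibre of a Schwartz function is integrable**: `v ↦ f(u, v)` is integrable on `V`. [cite: Weil1964, Chap. I n° 11] -/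
theorem integrable_fibre_withLp (f : 𝓢(WithLp 2 (U × V), F)) (u : U) :
    Integrable (fun v : V => f (WithLp.toLp 2 (u, v))) := by
  obtain ⟨C, -, h⟩ := exists_norm_fibre_le_withLp f (Module.finrank ℝ V + 1)
  refine Integrable.mono' ((integrable_one_add_norm ?_).const_mul C)
    ((f.continuous.comp (continuous_toLp_right u)).aestronglyMeasurable) (Filter.Eventually.of_forall (h u))
  push_cast
  linarith

omit [FiniteDimensional ℝ U] [MeasurableSpace U] [BorelSpace U] in
/-- **The fibre integral of a Schwartz function is continuous** (dominated convergence against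
`C (1 + ‖v‖)^{-(dim V + 1)}`). [cite: Weil1964, Chap. I n° 11] -/
theorem continuous_fibreIntegral_withLp (f : 𝓢(WithLp 2 (U × V), F)) :
    Continuous fun u : U => ∫ v : V, f (WithLp.toLp 2 (u, v)) := by
  obtain ⟨C, -, h⟩ := exists_norm_fibre_le_withLp f (Module.finrank ℝ V + 1)
  have hint : Integrable (fun v : V => C * (1 + ‖v‖) ^ (-((Module.finrank ℝ V + 1 : ℕ) : ℝ))) :=
    (integrable_one_add_norm (by push_cast; linarith)).const_mul C
  exact continuous_of_dominated (fun u => (integrable_fibre_withLp f u).aestronglyMeasurable)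
    (fun u => Filter.Eventually.of_forall (h u)) hint
    (Filter.Eventually.of_forall fun v => f.continuous.comp (continuous_toLp_left v))

/-- The Schwartz function read on `U × V` (through `toLp`) is integrable for the product volume. [cite: Weil1964, Chap. I n° 11] -/
theorem integrable_comp_toLp_prod (f : 𝓢(WithLp 2 (U × V), F)) :
    Integrable (fun p : U × V => f (WithLp.toLp 2 p)) ((volume : Measure U).prod (volume : Measure V)) := by
  have h := ((WithLp.volume_preserving_toLp U V).integrable_comp f.continuous.aestronglyMeasurable).2
    (f.integrable (μ := (volume : Measure (WithLp 2 (U × V)))))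
  rwa [Measure.volume_eq_prod] at h

/-- **The fibre integral of a Schwartz function is integrable** (Fubini). [cite: Weil1964, Chap. I n° 11] -/
theorem integrable_fibreIntegral_withLp (f : 𝓢(WithLp 2 (U × V), F)) :
    Integrable (fun u : U => ∫ v : V, f (WithLp.toLp 2 (u, v))) :=
  (integrable_comp_toLp_prod f).integral_prod_left

/-- **The Fourier transform of the fibre integral is the restriction of the Fourier transform to the first
factor**: `𝓕 (u ↦ ∫ f(u, v) dv) (ξ) = 𝓕 f (ξ, 0)` (Fubini and `⟪(u, v), (ξ, 0)⟫ = ⟪u, ξ⟫`). [cite: Weil1964, Chap. I n° 11] -/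
theorem fourier_fibreIntegral_withLp (f : 𝓢(WithLp 2 (U × V), F)) (ξ : U) :
    𝓕 (fun u : U => ∫ v : V, f (WithLp.toLp 2 (u, v))) ξ = 𝓕 (⇑f) (WithLp.toLp 2 (ξ, (0 : V))) := by
  rw [Real.fourier_eq, Real.fourier_eq]
  -- the integrand on `U × V`
  set L : U × V →L[ℝ] U →L[ℝ] ℝ := (innerSL ℝ (E := U)).comp (ContinuousLinearMap.fst ℝ U V) with hL
  have hLapply : ∀ (p : U × V) (w : U), L p w = ⟪p.1, w⟫ := fun p w => rfl
  have hint : Integrable (fun p : U × V => 𝐞 (-(L p ξ)) • f (WithLp.toLp 2 p))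
      ((volume : Measure U).prod (volume : Measure V)) :=
    (Real.fourierIntegral_convergent_iff' L ξ).2 (integrable_comp_toLp_prod f)
  -- Fubini on the left-hand side
  have hlhs : ∫ u : U, 𝐞 (-⟪u, ξ⟫) • ∫ v : V, f (WithLp.toLp 2 (u, v)) =
      ∫ p : U × V, 𝐞 (-(L p ξ)) • f (WithLp.toLp 2 p) ∂((volume : Measure U).prod (volume : Measure V)) := by
    rw [integral_prod _ hint]
    refine integral_congr_ae (Filter.Eventually.of_forall fun u => ?_)
    simp only [hLapply]
    exact (integral_smul _ _).symm
  rw [hlhs]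
  -- transport to `WithLp 2 (U × V)` along the measure-preserving `toLp`
  set g : WithLp 2 (U × V) → F := fun z => 𝐞 (-⟪z, WithLp.toLp 2 (ξ, (0 : V))⟫) • f z with hg
  have hcomp : (fun p : U × V => 𝐞 (-(L p ξ)) • f (WithLp.toLp 2 p)) = fun p => g (WithLp.toLp 2 p) := by
    funext p
    simp only [hg, WithLp.prod_inner_apply, inner_zero_right, add_zero, hLapply]
  rw [hcomp, ← Measure.volume_eq_prod,
    (WithLp.volume_preserving_toLp U V).integral_comp (MeasurableEquiv.toLp 2 (U × V)).measurableEmbedding g]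

variable [CompleteSpace F]

/-- **The fibre integral of a Schwartz function on `WithLp 2 (U × V)` is a Schwartz function on `U`**:
`∃ g ∈ 𝓢(U, F)` with `g(u) = ∫ f(u, v) dv`; namely `g = 𝓕⁻¹(ξ ↦ 𝓕 f(ξ, 0))`. [cite: Weil1964, Chap. I n° 11] -/
theorem exists_fibreIntegral_withLp (f : 𝓢(WithLp 2 (U × V), F)) :
    ∃ g : 𝓢(U, F), ∀ u, g u = ∫ v : V, f (WithLp.toLp 2 (u, v)) := by
  -- the linear isometry `ξ ↦ (ξ, 0)`
  set J : U →L[ℝ] WithLp 2 (U × V) :=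
    ((WithLp.prodContinuousLinearEquiv 2 ℝ U V).symm : U × V →L[ℝ] WithLp 2 (U × V)).comp
      (ContinuousLinearMap.inl ℝ U V) with hJ
  have hJapply : ∀ ξ, J ξ = WithLp.toLp 2 (ξ, (0 : V)) := fun ξ => rfl
  have hJgrowth : Function.HasTemperateGrowth (J : U → WithLp 2 (U × V)) := J.hasTemperateGrowth
  have hJupper : ∃ (k : ℕ) (C : ℝ), ∀ ξ : U, ‖ξ‖ ≤ C * (1 + ‖(J : U → WithLp 2 (U × V)) ξ‖) ^ k := by
    refine ⟨1, 1, fun ξ => ?_⟩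
    rw [hJapply, WithLp.norm_toLp_fst, pow_one, one_mul]
    linarith [norm_nonneg ξ]
  -- `R ξ = 𝓕 f (ξ, 0)` is Schwartz, and so is `G = 𝓕⁻¹ R`
  set R : 𝓢(U, F) := SchwartzMap.compCLM ℂ hJgrowth hJupper (𝓕 f) with hR
  have hRapply : ∀ ξ, R ξ = 𝓕 (⇑f) (WithLp.toLp 2 (ξ, (0 : V))) := fun ξ => by
    rw [hR, SchwartzMap.compCLM_apply, Function.comp_apply, hJapply, SchwartzMap.fourier_coe]
  refine ⟨𝓕⁻ R, fun u => ?_⟩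
  set g : U → F := fun u => ∫ v : V, f (WithLp.toLp 2 (u, v)) with hg
  have hFg : 𝓕 g = ⇑R := funext fun ξ => (fourier_fibreIntegral_withLp f ξ).trans (hRapply ξ).symm
  have hinv : 𝓕⁻ (𝓕 g) = g :=
    (continuous_fibreIntegral_withLp f).fourierInv_fourier_eq (integrable_fibreIntegral_withLp f)
      (by rw [hFg]; exact R.integrable)
  have h := congrFun hinv u
  rw [hFg] at h
  rw [SchwartzMap.fourierInv_coe]
  exact h

end Core

/-! ### Transport: arbitrary finite-dimensional spaces and Haar measures -/

section General

variable {E₁ E₂ : Type*} [NormedAddCommGroup E₁] [NormedSpace ℝ E₁] [FiniteDimensional ℝ E₁]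
  [NormedAddCommGroup E₂] [NormedSpace ℝ E₂] [FiniteDimensional ℝ E₂] [MeasurableSpace E₂] [BorelSpace E₂]
  {F : Type*} [NormedAddCommGroup F] [NormedSpace ℂ F] [CompleteSpace F]

/-- **The fibre integral of a Schwartz function is a Schwartz function.**  For finite-dimensional real normed
spaces `E₁, E₂`, an additive Haar measure `μ` on `E₂` and `f ∈ 𝓢(E₁ × E₂, F)` (`F` complete), there is
`g ∈ 𝓢(E₁, F)` with `g(x) = ∫ f(x, y) dμ(y)` for every `x`.  (Transport of `exists_fibreIntegral_withLp` along
linear isomorphisms with Euclidean spaces and Haar uniqueness `μ ∘ T₂⁻¹ = c · vol`.) [cite: Weil1964, Chap. I n° 11] [cite: KudlaRallis1994, §5] -/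
theorem exists_schwartz_fibreIntegral (f : 𝓢(E₁ × E₂, F)) (μ : Measure E₂) [μ.IsAddHaarMeasure] :
    ∃ g : 𝓢(E₁, F), ∀ x, g x = ∫ y, f (x, y) ∂μ := by
  -- Euclidean models
  set U : Type _ := EuclideanSpace ℝ (Fin (Module.finrank ℝ E₁)) with hU
  set V : Type _ := EuclideanSpace ℝ (Fin (Module.finrank ℝ E₂)) with hV
  have h₁ : Module.finrank ℝ E₁ = Module.finrank ℝ U :=
    (finrank_euclideanSpace_fin (𝕜 := ℝ) (n := Module.finrank ℝ E₁)).symm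
  have h₂ : Module.finrank ℝ E₂ = Module.finrank ℝ V :=
    (finrank_euclideanSpace_fin (𝕜 := ℝ) (n := Module.finrank ℝ E₂)).symm
  set T₁ : E₁ ≃L[ℝ] U := ContinuousLinearEquiv.ofFinrankEq h₁ with hT₁
  set T₂ : E₂ ≃L[ℝ] V := ContinuousLinearEquiv.ofFinrankEq h₂ with hT₂
  set Ψ : WithLp 2 (U × V) ≃L[ℝ] E₁ × E₂ :=
    (WithLp.prodContinuousLinearEquiv 2 ℝ U V).trans (T₁.symm.prodCongr T₂.symm) with hΨ
  have hΨapply : ∀ (u : U) (v : V), Ψ (WithLp.toLp 2 (u, v)) = (T₁.symm u, T₂.symm v) := fun u v => rfl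
  set f' : 𝓢(WithLp 2 (U × V), F) := SchwartzMap.compCLMOfContinuousLinearEquiv ℂ Ψ f with hf'
  have hf'apply : ∀ (u : U) (v : V), f' (WithLp.toLp 2 (u, v)) = f (T₁.symm u, T₂.symm v) := fun u v => by
    rw [hf', SchwartzMap.compCLMOfContinuousLinearEquiv_apply, Function.comp_apply, hΨapply]
  obtain ⟨g', hg'⟩ := exists_fibreIntegral_withLp f'
  -- Haar uniqueness on `V`: `μ ∘ T₂⁻¹ = c · vol`
  haveI : (μ.map T₂).IsAddHaarMeasure := T₂.isAddHaarMeasure_map μ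
  set c : ℝ≥0 := (μ.map T₂).addHaarScalarFactor (volume : Measure V) with hc
  have hμ : μ.map T₂ = c • (volume : Measure V) := Measure.isAddLeftInvariant_eq_smul _ _
  refine ⟨(c : ℝ) • SchwartzMap.compCLMOfContinuousLinearEquiv ℂ T₁ g', fun x => ?_⟩
  rw [_root_.smul_apply, SchwartzMap.compCLMOfContinuousLinearEquiv_apply, Function.comp_apply, hg']
  -- change variables `y = T₂⁻¹ v` in the `μ`-integral
  have hme : MeasurableEmbedding (T₂ : E₂ → V) := T₂.toHomeomorph.measurableEmbedding
  have hcv : ∫ v, f (x, T₂.symm v) ∂(μ.map T₂) = ∫ y, f (x, y) ∂μ := by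
    rw [hme.integral_map]
    simp only [ContinuousLinearEquiv.symm_apply_apply]
  rw [← hcv, hμ, integral_smul_nnreal_measure, NNReal.smul_def]
  refine congrArg _ (integral_congr_ae (Filter.Eventually.of_forall fun v => ?_))
  simp only [hf'apply, ContinuousLinearEquiv.symm_apply_apply]

/-- **Fibre integral in the FIRST variable**: for `f ∈ 𝓢(E₂ × E₁, F)` and an additive Haar measure `μ` on `E₂`
there is `g ∈ 𝓢(E₁, F)` with `g(x) = ∫ f(y, x) dμ(y)`. [cite: Weil1964, Chap. I n° 11] -/
theorem exists_schwartz_fibreIntegral_left (f : 𝓢(E₂ × E₁, F)) (μ : Measure E₂)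
    [μ.IsAddHaarMeasure] :
    ∃ g : 𝓢(E₁, F), ∀ x, g x = ∫ y, f (y, x) ∂μ := by
  obtain ⟨g, hg⟩ := exists_schwartz_fibreIntegral
    (SchwartzMap.compCLMOfContinuousLinearEquiv ℂ (ContinuousLinearEquiv.prodComm ℝ E₁ E₂) f) μ
  exact ⟨g, fun x => by simpa using hg x⟩

end General

/-! ### Coordinate splitting of a `Sum`-indexed product -/

section SumElim

variable {ι₁ ι₂ : Type*} [Fintype ι₁] [Fintype ι₂]
  {W : Type*} [NormedAddCommGroup W] [NormedSpace ℝ W] [FiniteDimensional ℝ W] [MeasurableSpace W] [BorelSpace W]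
  {F : Type*} [NormedAddCommGroup F] [NormedSpace ℂ F] [CompleteSpace F]

/-- **Integration along a block of coordinates preserves the Schwartz space**: for a finite-dimensional real
normed space `W`, finite index types `ι₁, ι₂`, an additive Haar measure `μ` on `ι₂ → W` and
`f ∈ 𝓢(ι₁ ⊕ ι₂ → W, F)`, there is `g ∈ 𝓢(ι₁ → W, F)` with `g(x) = ∫ f(Sum.elim x y) dμ(y)` for every `x`
(the coordinate splitting `(ι₁ ⊕ ι₂ → W) ≃ (ι₁ → W) × (ι₂ → W)` is a continuous linear isomorphism); at
`W = L⁺ ⊗ ℝ` this is the archimedean factor of «integration along a block of coordinates preserves `𝒮(𝔸^{ι₁ ⊕ ι₂})`».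
[cite: Weil1964, Chap. I n° 11] [cite: KudlaRallis1994, §5] -/
theorem exists_schwartz_fibreIntegral_sumElim (f : 𝓢((ι₁ ⊕ ι₂ → W), F)) (μ : Measure (ι₂ → W))
    [μ.IsAddHaarMeasure] :
    ∃ g : 𝓢((ι₁ → W), F), ∀ x, g x = ∫ y, f (Sum.elim x y) ∂μ := by
  set S : (ι₁ ⊕ ι₂ → W) ≃L[ℝ] (ι₁ → W) × (ι₂ → W) :=
    ContinuousLinearEquiv.sumPiEquivProdPi ℝ ι₁ ι₂ (fun _ => W) with hS
  have hSsymm : ∀ (x : ι₁ → W) (y : ι₂ → W), S.symm (x, y) = Sum.elim x y := by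
    intro x y
    funext i
    rcases i with i | i <;> rfl
  obtain ⟨g, hg⟩ := exists_schwartz_fibreIntegral (SchwartzMap.compCLMOfContinuousLinearEquiv ℂ S.symm f) μ
  refine ⟨g, fun x => ?_⟩
  rw [hg]
  refine integral_congr_ae (Filter.Eventually.of_forall fun y => ?_)
  simp only [SchwartzMap.compCLMOfContinuousLinearEquiv_apply, Function.comp_apply, hSsymm]

end SumElim

end Summit.HodgeConjecture.HodgeConjecture.Cruxes.HLiu418.K2LiuSchwartzFibreIntegral

end
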